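import Literature.NumberTheory.GaloisRepresentations.IdeleClassCharacterPairing
import HarnessLib

/-!
# The pairing `inv_{L/F}(ι[x] ∪ β_m[χ])` at the finite abelian layers `L ⊆ F̄` INSIDE the algebraic closure:
# `= −χ(ψ_{L|F} x)/m = −χ(γ|_L)/m` for every representative `γ ∈ Γ_F` of the universal symbol `θ[x]`
# (Tate, C–F VII §11.3, §5.4; Neukirch III §6 (6.13)–(6.14))

Topic `NumberTheory/GaloisRepresentations`; namespace `Literature.NumberTheory.GaloisRepresentations.IdeleCohomology`
(sequel to `IdeleClassCharacterPairing`).  Theorems only (no definition, no named fact, no instance, no notation, no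
`sorry`); number fields in `Type`.

`IdeleClassCharacterPairing` computes Milne's pairing `inv_{E/F}(ι[x] ∪ β_m[χ])` at ABSTRACT layers `E : Type`, where the
`θ`-form must pass through the tree's embedded copy `e : E ≃ E₀ ⊆ F̄`.  Route A's colimit over the open normal subgroups
`U ≤ Γ_F` (door-c4's `(d)`) reads its layers as the finite Galois `L = F̄^U ⊆ F̄` with `Γ_F ↠ Gal(L/F)` THE restriction
`absRestrictNormalHom L`; this file restates the abelian-layer identities in that currency, with no auxiliary embedding:

* §1 **`artinIdeleMap_eq_artinIdeleMapOfAlgebra`**: for a finite abelian `L ⊆ F̄` the tree's two Artin maps agree —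
  `artinIdeleMap L` (Tate §4.2, built from Hecke characters) `= artinIdeleMapOfAlgebra F L` (the abstract-extension
  transport), by the uniqueness theorem `artinIdeleMapOfAlgebra_unique` (open kernel, kills `Fˣ`, Frobenius at almost
  all places).
* §2 **`classInvAll_baseCup_bockstein_eq_artinIdeleMap`**: `inv_{L/F}(ι[x] ∪ β_m[χ]) = −χ(ψ_{L|F} x)/m` for every
  `χ : Gal(L/F) → ℤ/m`; **`classInvAll_baseCup_bockstein_eq_absRestrictNormalHom`**: `= −χ(γ|_L)/m` for every `γ ∈ Γ_F`
  with `absGaloisAbProj γ = θ[x]` (door-c6 g13 `isGlobalReciprocityMap_artinTheta`: `θ` is THE global reciprocity map);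
  kernel form.

HONEST FRAMING: corollaries of `IdeleClassCharacterPairing` and of the tree's reciprocity law; no case of BSD / Poitou–Tate.
Written for Route A (A5) of crux `AnticycControlAdditiveK` (cell bsd-schneider): these are the layer values of
`α¹(Γ_F, ℤ/m)` that door-c6 g11's `mem_range_pow_iff_forall_character_artinTheta` (injectivity) and
`ContinuousCharactersBiduality` (surjectivity) control.

## References
* J. W. S. Cassels, A. Fröhlich (eds.), *Algebraic Number Theory* (1967), Ch. VII (J. Tate) §4.2 Corollary, §5.1 Main
  Theorem, §5.4, §11.3. [CasselsFrohlichANT1967]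
* J. Neukirch, *Class Field Theory — The Bonn Lectures* (2013), Part III §6 (6.13)–(6.14), Thm. (7.12). [Neukirch2013]
* J.-P. Serre, *Local Fields*, GTM 67 (1979), XI §3 Prop. 2, XIV §1. [SerreLocalFields1979]
-/

noncomputable section

set_option backward.isDefEq.respectTransparency false

namespace Literature.NumberTheory.GaloisRepresentations

namespace IdeleCohomology

open CategoryTheory NumberField IsDedekindDomain groupCohomology Function Field Filter
open Literature.NumberTheory.Automorphic
open Literature.Algebra.Homology Literature.Algebra.Homology.Bockstein IdeleClassGroup
open Literature.AnabelianGeometry.AbsoluteAnabelian.Prop121vii (zmodToQmodZ zmodToQmodZ_apply)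

variable {F : Type} [Field F] [NumberField F]
variable (L : IntermediateField F (AlgebraicClosure F)) [FiniteDimensional F L] [NumberField L] [IsAbelianGalois F L]

/-! ## §1. The two Artin maps of an embedded abelian layer agree -/

/-- **`artinIdeleMap L = artinIdeleMapOfAlgebra F L`** for a finite abelian `L ⊆ F̄`: the Artin map of Tate §4.2 (from the
Hecke characters of `L/F`) has open kernel, kills the principal idèles and sends `⟨ϖ_v⟩ ↦ Frob_v` at every prime
unramified in `L`, so it is THE map characterised by `artinIdeleMapOfAlgebra_unique`.
[cite: CasselsFrohlichANT1967, Ch. VII §4.2 Corollary (i)–(iii), §5.1 Main Theorem (A)] -/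
theorem artinIdeleMap_eq_artinIdeleMapOfAlgebra (hR : artinReciprocity_character) :
    artinIdeleMap L hR = artinIdeleMapOfAlgebra F L hR := by
  refine artinIdeleMapOfAlgebra_unique F L hR (artinIdeleMap L hR) (isOpen_ker_artinIdeleMap L hR)
    (fun x hx => (MonoidHom.mem_ker).1 (principalIdeles_le_ker_artinIdeleMap L hR hx)) ?_
  have hunr : ∀ᶠ v : HeightOneSpectrum (𝓞 F) in cofinite, Algebra.IsUnramifiedIn (𝓞 L) v.asIdeal := by
    rw [eventually_cofinite]
    exact finite_setOf_not_isUnramifiedIn F L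
  filter_upwards [hunr] with v hv
  exact artinIdeleMap_localUnits_uniformizer L hR hv

/-! ## §2. The pairing at the embedded abelian layers -/

/-- **`inv_{L/F}(ι[x] ∪ β_m[χ]) = −χ(ψ_{L|F} x)/m`** for a finite abelian `L ⊆ F̄`, every `χ : Gal(L/F) → ℤ/m` and every
idèle `x` of `F`, with `ψ_{L|F} = artinIdeleMap L` THE Artin map of the embedded layer.
[cite: CasselsFrohlichANT1967, Ch. VII §11.3, §5.1 Main Theorem (C)][cite: SerreLocalFields1979, Ch. XI §3 Prop. 2] -/
theorem classInvAll_baseCup_bockstein_eq_artinIdeleMap (m : ℕ) [NeZero m] (χ : Additive (L ≃ₐ[F] L) →+ ZMod m)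
    (x : ideleGroup F) :
    classInvAll F L (baseCup (E := L) x
        (δ (intModShortComplex_shortExact (L ≃ₐ[F] L) m) 1 2 rfl
          ((H1IsoOfIsTrivial (Rep.trivial ℤ (L ≃ₐ[F] L) (ZMod m))).inv χ))) =
      -zmodToQmodZ m (χ (Additive.ofMul (artinIdeleMap L artinReciprocity_character_holds x))) := by
  rw [classInvAll_baseCup_bockstein_eq_of_isAbelianGalois F L m χ x,
    artinIdeleMap_eq_artinIdeleMapOfAlgebra L artinReciprocity_character_holds]

/-- **`inv_{L/F}(ι[x] ∪ β_m[χ]) = −χ(γ|_L)/m`** for every `γ ∈ Γ_F` representing the universal norm residue symbol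
`θ[x] ∈ Γ_F^{ab}` (`γ|_L = absRestrictNormalHom L γ`, THE restriction): the layer values of Milne's `α¹(Γ_F, ℤ/m)` for the
idèle class formation are the values of the `ℤ/m`-characters of `Γ_F` on `θ[x]`.
[cite: CasselsFrohlichANT1967, Ch. VII §11.3, §5.4][cite: Neukirch2013, Part III §6 (6.13), (6.14)]
[cite: MilneADT2006, Ch. I Thm. 1.8 (b)] -/
theorem classInvAll_baseCup_bockstein_eq_absRestrictNormalHom (m : ℕ) [NeZero m]
    (χ : Additive (L ≃ₐ[F] L) →+ ZMod m) (x : ideleGroup F) {γ : absoluteGaloisGroup F}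
    (hγ : absGaloisAbProj F γ =
      (isCompatibleSystem_artinMapFamily (K := F) artinReciprocity_character_holds).theta (QuotientGroup.mk x)) :
    classInvAll F L (baseCup (E := L) x
        (δ (intModShortComplex_shortExact (L ≃ₐ[F] L) m) 1 2 rfl
          ((H1IsoOfIsTrivial (Rep.trivial ℤ (L ≃ₐ[F] L) (ZMod m))).inv χ))) =
      -zmodToQmodZ m (χ (Additive.ofMul (absRestrictNormalHom L γ))) := by
  rw [classInvAll_baseCup_bockstein_eq_artinIdeleMap L m χ x,
    absRestrictNormalHom_eq_artinIdeleMap_of_absGaloisAbProj_eq L hγ]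

/-- **The kernel at an embedded abelian layer**: `inv_{L/F}(ι[x] ∪ β_m[χ]) = 0 ↔ χ(ψ_{L|F} x) = 0`.
[cite: CasselsFrohlichANT1967, Ch. VII §11.3, §5.1 Main Theorem (B)] -/
theorem classInvAll_baseCup_bockstein_eq_zero_iff_artinIdeleMap (m : ℕ) [NeZero m]
    (χ : Additive (L ≃ₐ[F] L) →+ ZMod m) (x : ideleGroup F) :
    classInvAll F L (baseCup (E := L) x
        (δ (intModShortComplex_shortExact (L ≃ₐ[F] L) m) 1 2 rfl
          ((H1IsoOfIsTrivial (Rep.trivial ℤ (L ≃ₐ[F] L) (ZMod m))).inv χ))) = 0 ↔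
      χ (Additive.ofMul (artinIdeleMap L artinReciprocity_character_holds x)) = 0 := by
  rw [classInvAll_baseCup_bockstein_eq_artinIdeleMap L m χ x, neg_eq_zero, ← map_zero (zmodToQmodZ m)]
  exact (Literature.AnabelianGeometry.AbsoluteAnabelian.Prop121vii.zmodToQmodZ_injective m).eq_iff

end IdeleCohomology

end Literature.NumberTheory.GaloisRepresentations

end
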